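import Summits.CriticalPhenomena.Ising3D.Control2DConvergenceRate
import Mathlib.Algebra.Order.BigOperators.Ring.Finset
import Mathlib.Analysis.SpecialFunctions.Pow.Real
import Mathlib.Analysis.SpecialFunctions.Sqrt
import Mathlib.Tactic.Linarith
import Mathlib.Tactic.Positivity
import Mathlib.Tactic.FieldSimp
import Mathlib.Tactic.Ring
import Mathlib.Tactic.NormNum
import HarnessLib

/-!
# The radial variable `ρ` of Pappadopulo–Rychkov–Espin–Rattazzi for the chiral blocks: `k_{2h}(z) ≥ (4ρ)^h` by Cauchy–Schwarz
(cell `pub-ising3x`, seat controls-1 gen 47; PAPER §6.2 / Appendix E — CONTROL-ONLY; companion of `Control2DConvergenceRate`)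

HONEST FRAMING: lottery ticket; floor = tightest certified 3D Ising CFT bounds; no exact-solution
claim without a proof. CONTROL-ONLY (`d = 2`, global `sl(2) × sl(2)` blocks, `Δ_σ = s` an INPUT, axiom set `A2D′`);
nothing here is about `d = 3`, no certificate, functional or number of the record is touched, and no new hypothesis,
definition or named fact enters. This file is PURE BLOCK ANALYSIS (no datum): the typed-class consequences are in
`Control2DOpeDecay`.

WHAT THIS FILE ADDS. Pappadopulo–Rychkov–Espin–Rattazzi 2012, §5.2 write the cross-ratio as `z = 4ρ/(1+ρ)²`,
`ρ = ρ(z) = z/(1+√(1-z))² = (1-√(1-z))/(1+√(1-z))` (the radial variable mapping the cut plane onto the unit disc; on the real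
segment `z ∈ (0,1) ↔ ρ ∈ (0,1)`, `ρ < z ≤ 4ρ`, `ρ(½) = 3 - 2√2 ≈ 0.17`), and obtain from the Hilbert-space structure of a CFT
that the expansion of the correlator in powers of `ρ` has NON-NEGATIVE coefficients, whence the sharp convergence rate
`|ρ(z)|^{Δ_*}` and the density `F(E) ∼ E^{4Δ_φ}/Γ(4Δ_φ+1)` in the `ρ`-frame. For the typed two-dimensional class the blocks are
CLOSED FORMS, `k_{2h}(z) = z^h ₂F₁(h,h;2h;z) = Σ_m a_m(h) z^{h+m}` (`hasSum_chiralBlock`), and positivity in `ρ` is the quadratic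
transformation `k_{2h}(z) = (4ρ)^h ₂F₁(½,h;h+½;ρ²)` (Hogervorst–Rychkov 2013) — NOT proved here. What IS proved, elementarily,
is its LEADING-TERM INEQUALITY, which is all the typed-class consequences of `Control2DOpeDecay` need:

* **`rpow_four_mul_le_chiralBlock`** — `(4ρ)^h ≤ k_{2h}(4ρ/(1+ρ)²)` for `h ≥ 0`, `ρ ∈ (0,1)`. PROOF (Cauchy–Schwarz): with
  `c_m = (h)_m/m!`, `d_m = (2h)_m/m!` one has `a_m(h) = (h)_m²/(m!(2h)_m) = c_m²/d_m` (`chiralCoeff_eq_poch`), so for the partial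
  sums `(Σ_{m<N} c_m t^m)² ≤ (Σ_{m<N} a_m z^m)(Σ_{m<N} d_m (t²/z)^m)` (Mathlib's `Finset.sum_sq_le_sum_mul_sum_of_sq_le_mul`); at
  `t = 2ρ/(1+ρ)`, `z = 4ρ/(1+ρ)²` one has `t² = zρ` and `1 - t = (1-ρ)/(1+ρ)`, and the two binomial series
  (`hasSum_poch_div_factorial_mul_pow`) give `((1+ρ)/(1-ρ))^{2h} ≤ ₂F₁(h,h;2h;z) · (1-ρ)^{-2h}`, i.e. `₂F₁(h,h;2h;z) ≥ (1+ρ)^{2h}`,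
  and `z^h (1+ρ)^{2h} = (4ρ)^h`;
* `chiralBlock_le_rpow_div` — the uniform envelope `k_{2h}(z) ≤ (z/(1-z))^h` (`(h)_m ≤ (2h)_m`, one binomial series);
* **`two_mul_rpow_four_mul_le_globalBlock_diag`** / `globalBlock_diag_le_two_mul_rpow_div` — for a unitary label `ℓ ≤ Δ`:
  `2(4ρ)^Δ ≤ g_{Δ,ℓ}(z,z)` at `z = 4ρ/(1+ρ)²` and `g_{Δ,ℓ}(z,z) ≤ 2(z/(1-z))^Δ` on `(0,1)` — gen 43's `2z^Δ ≤ g_{Δ,ℓ}(z,z)`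
  (`two_mul_rpow_le_globalBlock_diag`) sharpened by the factor `(4ρ/z)^Δ = (2/(1+√(1-z)))^{2Δ} → 4^Δ` as `z → 1`;
* the algebra of `z(ρ) = 4ρ/(1+ρ)²` on `(0,1)` (`four_mul_div_sq_mem_Ioo`, `one_sub_four_mul_div_sq`, `four_mul_div_sq_div_one_sub`:
  `1 - z = ((1-ρ)/(1+ρ))²`, `z/(1-z) = 4ρ/(1-ρ)²`), every `z ∈ (0,1)` is a `z(ρ)` (`four_mul_rhoZ_div_sq`, `rhoZ_mem_Ioo`, with
  PRER's `ρ(z) = (1-√(1-z))/(1+√(1-z))` written out — no definition is introduced), the same bound in the `z`-parametrisation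
  (`rpow_four_mul_rhoZ_le_chiralBlock`), and `ρ(½) = 3 - 2√2 < 0.1716` (`rhoZ_half_lt`).

NOT claimed: the `ρ`-EXPANSION itself / positivity of all `ρ`-coefficients of `k_{2h}` (Hogervorst–Rychkov 2013's
`(4ρ)^h ₂F₁(½,h;h+½;ρ²)` — the quadratic transformation; only its leading-term inequality is proved), hence NOT the sharp rate
`|ρ(z)|^{Δ_*}` of Pappadopulo–Rychkov–Espin–Rattazzi (it needs the UPPER half `k_{2h} ≤ (4ρ)^h(1-ρ²)^{-1/2}`) and NOT the Tauberian
EQUALITY `F_ρ(E) ∼ 16^s E^{4s}/Γ(4s+1)` (it needs positivity of the full `ρ`-states series; upper bounds only, as E.1n stood before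
E.1u); no lower bound on any `p_i`; anything off the real diagonal beyond monotone domination; complex `z` / the cut plane; `s = 0`;
Virasoro; anything three-dimensional; no certificate, functional or number of the record touched, no new hypothesis or named fact.
The two papers are CONTEXT for what is proved, not cited inputs: every step below is elementary real analysis on the tree's
closed-form blocks.

References: D. Pappadopulo, S. Rychkov, J. Espin, R. Rattazzi, Phys. Rev. D 86 (2012) 105043, §5.2 (the variable `ρ(z)`,
`z = 4ρ/(1+ρ)²`, `ρ(½) ≈ 0.17`) [cite: PappadopuloRychkovEspinRattazzi2012PRD, §5.2]; M. Hogervorst, S. Rychkov, Phys. Rev. D 87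
(2013) 106004, §2 (the `ρ`-series of conformal blocks; context only) [cite: HogervorstRychkov2013, §2]; F. A. Dolan, H. Osborn,
Nucl. Phys. B 678 (2004) 491, §3 [cite: DolanOsborn2004, §3]. Tree: `chiralBlock`, `globalBlock`, `chiralBlock_zero`
(`Control2DBootstrap`); `chiralCoeff`, `chiralCoeff_nonneg`, `hasSum_chiralBlock` (`Control2DTermwise`); `chiralCoeff_eq_poch`
(`Control2DGFFChiral`); `chiralBlock_nonneg` (`Control2DNonVacuity`); `poch`, `poch_pos`, `poch_succ`,
`hasSum_poch_div_factorial_mul_pow` (Literature `ConformalBootstrap3D.MeanFieldCoefficients` / `MeanFieldDecomposition`, the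
binomial series via Mathlib's `Real.one_div_one_sub_rpow_hasFPowerSeriesOnBall_zero`). Mathlib:
`Finset.sum_sq_le_sum_mul_sum_of_sq_le_mul` (Cauchy–Schwarz without square roots), `sum_le_hasSum`, `HasSum.tendsto_sum_nat`,
`le_of_tendsto'`, `Real.rpow_*`, `Real.sqrt_*`.
-/

namespace Summit.CriticalPhenomena.Ising3D.Control2D

open Set Filter Topology
open Literature.MathematicalPhysics.QuantumFieldTheory.ConformalBootstrap3D

/-! ### The algebra of `z(ρ) = 4ρ/(1+ρ)²` on `(0,1)` -/

/-- `z(ρ) = 4ρ/(1+ρ)² ∈ (0,1)` for `ρ ∈ (0,1)` (`z < 1 ⇔ (1-ρ)² > 0`). [cite: PappadopuloRychkovEspinRattazzi2012PRD, §5.2] -/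
theorem four_mul_div_sq_mem_Ioo {ρ : ℝ} (hρ : ρ ∈ Ioo (0 : ℝ) 1) : 4 * ρ / (1 + ρ) ^ 2 ∈ Ioo (0 : ℝ) 1 := by
  have h1 : 0 < (1 + ρ) ^ 2 := by nlinarith [hρ.1]
  refine ⟨div_pos (by linarith [hρ.1]) h1, ?_⟩
  rw [div_lt_one h1]
  nlinarith [hρ.2, sq_nonneg (1 - ρ)]

/-- `1 - z(ρ) = ((1-ρ)/(1+ρ))²` (`ρ ≥ 0`). [cite: PappadopuloRychkovEspinRattazzi2012PRD, §5.2] -/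
theorem one_sub_four_mul_div_sq {ρ : ℝ} (hρ : 0 ≤ ρ) : 1 - 4 * ρ / (1 + ρ) ^ 2 = ((1 - ρ) / (1 + ρ)) ^ 2 := by
  have h1 : (1 + ρ) ≠ 0 := by linarith
  field_simp
  ring

/-- `z(ρ)/(1 - z(ρ)) = 4ρ/(1-ρ)²` for `ρ ∈ [0,1)`. [cite: PappadopuloRychkovEspinRattazzi2012PRD, §5.2] -/
theorem four_mul_div_sq_div_one_sub {ρ : ℝ} (hρ0 : 0 ≤ ρ) (hρ1 : ρ < 1) :
    4 * ρ / (1 + ρ) ^ 2 / (1 - 4 * ρ / (1 + ρ) ^ 2) = 4 * ρ / (1 - ρ) ^ 2 := by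
  rw [one_sub_four_mul_div_sq hρ0]
  have h1 : (1 + ρ) ≠ 0 := by linarith
  have h2 : (1 - ρ) ≠ 0 := by linarith
  field_simp

/-- `ρ < z(ρ) ≤ 4ρ` on `(0,1)`: `z/ρ = 4/(1+ρ)² ∈ (1,4)`, `→ 4` as `z → 0` and `→ 1` as `z → 1` (where `4ρ → 4`).
[cite: PappadopuloRychkovEspinRattazzi2012PRD, §5.2] -/
theorem lt_four_mul_div_sq_and_le {ρ : ℝ} (hρ : ρ ∈ Ioo (0 : ℝ) 1) :
    ρ < 4 * ρ / (1 + ρ) ^ 2 ∧ 4 * ρ / (1 + ρ) ^ 2 ≤ 4 * ρ := by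
  have h1 : 0 < (1 + ρ) ^ 2 := by nlinarith [hρ.1]
  have hlt4 : (1 + ρ) ^ 2 < 4 := by nlinarith [hρ.1, hρ.2]
  have hge1 : 1 ≤ (1 + ρ) ^ 2 := by nlinarith [hρ.1]
  constructor
  · rw [lt_div_iff₀ h1]; nlinarith [mul_lt_mul_of_pos_left hlt4 hρ.1]
  · rw [div_le_iff₀ h1]
    nlinarith [mul_le_mul_of_nonneg_left hge1 (by linarith [hρ.1] : (0 : ℝ) ≤ 4 * ρ)]

/-- PRER's `ρ(z) = (1-√(1-z))/(1+√(1-z))` lies in `(0,1)` for `z ∈ (0,1)`. [cite: PappadopuloRychkovEspinRattazzi2012PRD, §5.2] -/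
theorem rhoZ_mem_Ioo {z : ℝ} (hz : z ∈ Ioo (0 : ℝ) 1) :
    (1 - Real.sqrt (1 - z)) / (1 + Real.sqrt (1 - z)) ∈ Ioo (0 : ℝ) 1 := by
  have hq0 : 0 < Real.sqrt (1 - z) := Real.sqrt_pos.mpr (by linarith [hz.2])
  have hq1 : Real.sqrt (1 - z) < 1 := by
    rw [Real.sqrt_lt' one_pos]; linarith [hz.1]
  have hden : 0 < 1 + Real.sqrt (1 - z) := by linarith
  refine ⟨div_pos (by linarith) hden, ?_⟩
  rw [div_lt_one hden]; linarith

/-- `ρ(z) = z/(1+√(1-z))²` — the two printed forms of PRER's radial variable agree on `(0,1)` (`1 - √(1-z)·√(1-z) = z`).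
[cite: PappadopuloRychkovEspinRattazzi2012PRD, §5.2] -/
theorem rhoZ_eq_div_sq {z : ℝ} (hz : z ∈ Ioo (0 : ℝ) 1) :
    (1 - Real.sqrt (1 - z)) / (1 + Real.sqrt (1 - z)) = z / (1 + Real.sqrt (1 - z)) ^ 2 := by
  have hq0 : 0 ≤ Real.sqrt (1 - z) := Real.sqrt_nonneg _
  have hsq : Real.sqrt (1 - z) ^ 2 = 1 - z := Real.sq_sqrt (by linarith [hz.2])
  have hden : (1 + Real.sqrt (1 - z)) ≠ 0 := by linarith
  rw [div_eq_div_iff hden (pow_ne_zero 2 hden)]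
  nlinarith [hsq]

/-- Every `z ∈ (0,1)` is a `z(ρ)`: `4ρ(z)/(1+ρ(z))² = z` for `ρ(z) = (1-√(1-z))/(1+√(1-z))` (so the `ρ`-parametrised statements below
cover the whole segment). [cite: PappadopuloRychkovEspinRattazzi2012PRD, §5.2] -/
theorem four_mul_rhoZ_div_sq {z : ℝ} (hz : z ∈ Ioo (0 : ℝ) 1) :
    4 * ((1 - Real.sqrt (1 - z)) / (1 + Real.sqrt (1 - z))) /
        (1 + (1 - Real.sqrt (1 - z)) / (1 + Real.sqrt (1 - z))) ^ 2 = z := by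
  set q : ℝ := Real.sqrt (1 - z) with hq
  have hq0 : 0 ≤ q := Real.sqrt_nonneg _
  have hsq : q ^ 2 = 1 - z := Real.sq_sqrt (by linarith [hz.2])
  have hden : (1 + q) ≠ 0 := by linarith
  have h1 : 1 + (1 - q) / (1 + q) = 2 / (1 + q) := by field_simp; ring
  rw [h1]
  field_simp
  nlinarith [hsq]

/-- `ρ(½) = (1-√½)/(1+√½) = 3 - 2√2 < 0.1716` («for `z = 1/2` we have `ρ(z) ≈ 0.17`»). [cite: PappadopuloRychkovEspinRattazzi2012PRD, §5.2] -/
theorem rhoZ_half_lt : (1 - Real.sqrt (1 - 1 / 2)) / (1 + Real.sqrt (1 - 1 / 2)) < (1716 : ℝ) / 10000 := by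
  have hq : (7071 : ℝ) / 10000 < Real.sqrt (1 - 1 / 2) := by
    rw [show (1 : ℝ) - 1 / 2 = 1 / 2 by norm_num, Real.lt_sqrt (by norm_num)]
    norm_num
  have hden : 0 < 1 + Real.sqrt (1 - 1 / 2) := by positivity
  rw [div_lt_div_iff₀ hden (by norm_num)]
  nlinarith [hq]

/-! ### Pochhammer bookkeeping: `a_m(h) = c_m²/d_m`, `(h)_m ≤ (2h)_m` -/

/-- `(x)_n ≤ (y)_n` for `0 ≤ x ≤ y`. [folklore] -/
theorem poch_le_poch_of_le {x y : ℝ} (hx : 0 ≤ x) (hxy : x ≤ y) (n : ℕ) : poch x n ≤ poch y n := by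
  induction n with
  | zero => simp
  | succ n ih =>
    rw [poch_succ, poch_succ]
    have h0 : 0 ≤ poch x n := by
      rcases hx.lt_or_eq with hpos | hzero
      · exact (poch_pos hpos n).le
      · subst hzero
        unfold poch
        exact Finset.prod_nonneg fun i _ => by positivity
    exact mul_le_mul ih (by linarith) (by positivity) (h0.trans ih)

/-- `a_m(h) ≤ (h)_m/m!` for `h > 0` (`(h)_m ≤ (2h)_m`): the coefficients of `₂F₁(h,h;2h;·)` are dominated by those of the binomial
series `(1-z)^{-h}`. [folklore] -/
theorem chiralCoeff_le_poch_div_factorial {h : ℝ} (hh : 0 < h) (m : ℕ) :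
    chiralCoeff h m ≤ poch h m / (m.factorial : ℝ) := by
  rw [chiralCoeff_eq_poch]
  have hf : 0 < (m.factorial : ℝ) := by positivity
  have hp2 : 0 < poch (2 * h) m := poch_pos (by linarith) m
  have hp1 : 0 ≤ poch h m := (poch_pos hh m).le
  have hle : poch h m ≤ poch (2 * h) m := poch_le_poch_of_le hh.le (by linarith) m
  rw [div_le_div_iff₀ (mul_pos hf hp2) hf]
  calc poch h m ^ 2 * (m.factorial : ℝ) = poch h m * poch h m * (m.factorial : ℝ) := by ring
    _ ≤ poch h m * poch (2 * h) m * (m.factorial : ℝ) := by gcongr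
    _ = poch h m / 1 * ((m.factorial : ℝ) * poch (2 * h) m) * 1 := by ring
    _ = poch h m * ((m.factorial : ℝ) * poch (2 * h) m) := by ring

/-- **The Cauchy–Schwarz identity behind the lower bound**: `(c_m t^m)² = (a_m z^m) · (d_m ρ^m)` whenever `t² = zρ`, where
`c_m = (h)_m/m!`, `d_m = (2h)_m/m!`, `a_m = (h)_m²/(m!(2h)_m)` (`h > 0`). [folklore] -/
theorem chiralCoeff_cs_sq_eq {h : ℝ} (hh : 0 < h) {t z ρ : ℝ} (htz : t ^ 2 = z * ρ) (m : ℕ) :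
    (poch h m / (m.factorial : ℝ) * t ^ m) ^ 2 =
      (chiralCoeff h m * z ^ m) * (poch (2 * h) m / (m.factorial : ℝ) * ρ ^ m) := by
  rw [chiralCoeff_eq_poch]
  have hf : (m.factorial : ℝ) ≠ 0 := by positivity
  have hp2 : poch (2 * h) m ≠ 0 := poch_ne_zero (by linarith) m
  have ht2m : (t ^ m) ^ 2 = z ^ m * ρ ^ m := by rw [← mul_pow, ← htz, ← pow_mul, mul_comm, pow_mul]
  field_simp
  rw [ht2m]
  ring

/-! ### The chiral block without its prefactor: `₂F₁(h,h;2h;z) = Σ_m a_m z^m` -/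

/-- For `0 < z < 1`: `Σ_m a_m(h) z^m = k_{2h}(z) · (z^h)⁻¹` (`hasSum_chiralBlock` with the prefactor `z^h` divided out). [folklore] -/
theorem hasSum_chiralCoeff_mul_pow (h : ℝ) {z : ℝ} (hz0 : 0 < z) (hz1 : z < 1) :
    HasSum (fun m : ℕ => chiralCoeff h m * z ^ m) (chiralBlock h z * (z ^ h)⁻¹) := by
  have H := (hasSum_chiralBlock h hz0 hz1).mul_right ((z ^ h)⁻¹)
  refine H.congr_fun fun m => ?_
  have hzh : z ^ h ≠ 0 := (Real.rpow_pos_of_pos hz0 h).ne'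
  rw [Real.rpow_add hz0, Real.rpow_natCast]
  field_simp

/-- `Σ_m a_m(h) z^m ≤ (1-z)^{-h}` for `h > 0`, `0 < z < 1` (termwise domination by the binomial series). [folklore] -/
theorem chiralBlock_mul_inv_rpow_le {h z : ℝ} (hh : 0 < h) (hz0 : 0 < z) (hz1 : z < 1) :
    chiralBlock h z * (z ^ h)⁻¹ ≤ 1 / (1 - z) ^ h := by
  have habs : |z| < 1 := by rw [abs_lt]; constructor <;> linarith
  refine hasSum_le (fun m => ?_) (hasSum_chiralCoeff_mul_pow h hz0 hz1) (hasSum_poch_div_factorial_mul_pow h habs)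
  exact mul_le_mul_of_nonneg_right (chiralCoeff_le_poch_div_factorial hh m) (pow_nonneg hz0.le m)

/-- **The uniform envelope** `k_{2h}(z) ≤ (z/(1-z))^h` for `h ≥ 0`, `z ∈ (0,1)` (equality at `h = 0`). [folklore] -/
theorem chiralBlock_le_rpow_div {h z : ℝ} (hh : 0 ≤ h) (hz0 : 0 < z) (hz1 : z < 1) :
    chiralBlock h z ≤ (z / (1 - z)) ^ h := by
  rcases hh.lt_or_eq with hpos | hzero
  · have hzh : 0 < z ^ h := Real.rpow_pos_of_pos hz0 h
    have h1 := chiralBlock_mul_inv_rpow_le hpos hz0 hz1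
    have h2 : chiralBlock h z = chiralBlock h z * (z ^ h)⁻¹ * z ^ h := by field_simp
    have h3 : (z / (1 - z)) ^ h = 1 / (1 - z) ^ h * z ^ h := by
      rw [Real.div_rpow hz0.le (by linarith)]; ring
    rw [h2, h3]
    exact mul_le_mul_of_nonneg_right h1 hzh.le
  · subst hzero; rw [chiralBlock_zero, Real.rpow_zero]

/-! ### The lower bound `k_{2h}(z(ρ)) ≥ (4ρ)^h` -/

/-- **Cauchy–Schwarz on the partial sums** (`h > 0`, `ρ ∈ (0,1)`, `t = 2ρ/(1+ρ)`, `z = 4ρ/(1+ρ)²`, so `t² = zρ`): for every `N`,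
`(Σ_{m<N} c_m t^m)² ≤ (k_{2h}(z) z^{-h}) · (1-ρ)^{-2h}`. [folklore] -/
theorem cs_partial_sq_le {h ρ : ℝ} (hh : 0 < h) (hρ : ρ ∈ Ioo (0 : ℝ) 1) (N : ℕ) :
    (∑ m ∈ Finset.range N, poch h m / (m.factorial : ℝ) * (2 * ρ / (1 + ρ)) ^ m) ^ 2 ≤
      (chiralBlock h (4 * ρ / (1 + ρ) ^ 2) * ((4 * ρ / (1 + ρ) ^ 2) ^ h)⁻¹) * (1 / (1 - ρ) ^ (2 * h)) := by
  have hz := four_mul_div_sq_mem_Ioo hρ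
  set z : ℝ := 4 * ρ / (1 + ρ) ^ 2 with hzdef
  have h1ρ : (1 + ρ) ≠ 0 := by linarith [hρ.1]
  have htz : (2 * ρ / (1 + ρ)) ^ 2 = z * ρ := by rw [hzdef]; field_simp; ring
  have hρabs : |ρ| < 1 := by rw [abs_lt]; constructor <;> linarith [hρ.1, hρ.2]
  -- Cauchy–Schwarz for the finite family
  have hCS := Finset.sum_sq_le_sum_mul_sum_of_sq_le_mul (Finset.range N)
    (r := fun m : ℕ => poch h m / (m.factorial : ℝ) * (2 * ρ / (1 + ρ)) ^ m)
    (f := fun m : ℕ => chiralCoeff h m * z ^ m) (g := fun m : ℕ => poch (2 * h) m / (m.factorial : ℝ) * ρ ^ m)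
    (fun m _ => mul_nonneg (chiralCoeff_nonneg hh.le m) (pow_nonneg hz.1.le m))
    (fun m _ => mul_nonneg (div_nonneg (poch_pos (by linarith) m).le (by positivity)) (pow_nonneg hρ.1.le m))
    (fun m _ => (chiralCoeff_cs_sq_eq hh htz m).le)
  -- the two non-negative series are bounded by their sums
  have hA : ∑ m ∈ Finset.range N, chiralCoeff h m * z ^ m ≤ chiralBlock h z * (z ^ h)⁻¹ :=
    sum_le_hasSum (Finset.range N) (fun m _ => mul_nonneg (chiralCoeff_nonneg hh.le m) (pow_nonneg hz.1.le m))
      (hasSum_chiralCoeff_mul_pow h hz.1 hz.2)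
  have hD : ∑ m ∈ Finset.range N, poch (2 * h) m / (m.factorial : ℝ) * ρ ^ m ≤ 1 / (1 - ρ) ^ (2 * h) :=
    sum_le_hasSum (Finset.range N)
      (fun m _ => mul_nonneg (div_nonneg (poch_pos (by linarith) m).le (by positivity)) (pow_nonneg hρ.1.le m))
      (hasSum_poch_div_factorial_mul_pow (2 * h) hρabs)
  have hA0 : 0 ≤ ∑ m ∈ Finset.range N, chiralCoeff h m * z ^ m :=
    Finset.sum_nonneg fun m _ => mul_nonneg (chiralCoeff_nonneg hh.le m) (pow_nonneg hz.1.le m)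
  have hD0 : 0 ≤ 1 / (1 - ρ) ^ (2 * h) := by
    have : 0 < (1 - ρ) ^ (2 * h) := Real.rpow_pos_of_pos (by linarith [hρ.2]) _
    positivity
  exact hCS.trans (mul_le_mul hA hD (Finset.sum_nonneg fun m _ =>
    mul_nonneg (div_nonneg (poch_pos (by linarith) m).le (by positivity)) (pow_nonneg hρ.1.le m)) (hA0.trans hA))

/-- **`₂F₁(h,h;2h;z(ρ)) ≥ (1+ρ)^{2h}`**, in the form `(1+ρ)^{2h} ≤ k_{2h}(z) · z^{-h}` (`h > 0`, `ρ ∈ (0,1)`, `z = 4ρ/(1+ρ)²`): the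
limit `N → ∞` of `cs_partial_sq_le` (`Σ_m c_m t^m = (1-t)^{-h} = ((1+ρ)/(1-ρ))^h`). [folklore] -/
theorem rpow_one_add_le_chiralBlock_mul_inv {h ρ : ℝ} (hh : 0 < h) (hρ : ρ ∈ Ioo (0 : ℝ) 1) :
    (1 + ρ) ^ (2 * h) ≤ chiralBlock h (4 * ρ / (1 + ρ) ^ 2) * ((4 * ρ / (1 + ρ) ^ 2) ^ h)⁻¹ := by
  set A : ℝ := chiralBlock h (4 * ρ / (1 + ρ) ^ 2) * ((4 * ρ / (1 + ρ) ^ 2) ^ h)⁻¹ with hAdef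
  have hP : 0 < 1 + ρ := by linarith [hρ.1]
  have hQ : 0 < 1 - ρ := by linarith [hρ.2]
  have ht1 : 1 - 2 * ρ / (1 + ρ) = (1 - ρ) / (1 + ρ) := by field_simp; ring
  have htabs : |2 * ρ / (1 + ρ)| < 1 := by
    rw [abs_lt]; constructor
    · have : 0 < 2 * ρ / (1 + ρ) := div_pos (by linarith [hρ.1]) hP
      linarith
    · rw [div_lt_one hP]; linarith [hρ.2]
  -- the binomial series at `t`: partial sums → (1-t)^{-h}
  have hT := (hasSum_poch_div_factorial_mul_pow h htabs).tendsto_sum_nat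
  rw [ht1] at hT
  have hT2 := hT.pow 2
  have hbound := le_of_tendsto' hT2 (fun N => cs_partial_sq_le hh hρ N)
  -- unpack the powers: `(1/((1-ρ)/(1+ρ))^h)² = (1+ρ)^{2h} / (1-ρ)^{2h}` and `1/(1-ρ)^{2h}`
  have hQ2h : 0 < (1 - ρ) ^ (2 * h) := Real.rpow_pos_of_pos hQ _
  have hP2h : 0 < (1 + ρ) ^ (2 * h) := Real.rpow_pos_of_pos hP _
  have hsq : (1 / ((1 - ρ) / (1 + ρ)) ^ h) ^ 2 = (1 + ρ) ^ (2 * h) / (1 - ρ) ^ (2 * h) := by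
    rw [Real.div_rpow hQ.le hP.le, one_div, inv_div, div_pow, ← Real.rpow_natCast ((1 + ρ) ^ h),
      ← Real.rpow_natCast ((1 - ρ) ^ h), ← Real.rpow_mul hP.le, ← Real.rpow_mul hQ.le]
    push_cast
    ring_nf
  rw [hsq] at hbound
  -- `(1+ρ)^{2h}/(1-ρ)^{2h} ≤ A · (1/(1-ρ)^{2h})` ⇒ `(1+ρ)^{2h} ≤ A`
  have h2 : (1 + ρ) ^ (2 * h) / (1 - ρ) ^ (2 * h) * (1 - ρ) ^ (2 * h) ≤
      A * (1 / (1 - ρ) ^ (2 * h)) * (1 - ρ) ^ (2 * h) := mul_le_mul_of_nonneg_right hbound hQ2h.le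
  have h3 : (1 + ρ) ^ (2 * h) / (1 - ρ) ^ (2 * h) * (1 - ρ) ^ (2 * h) = (1 + ρ) ^ (2 * h) := by
    field_simp
  have h4 : A * (1 / (1 - ρ) ^ (2 * h)) * (1 - ρ) ^ (2 * h) = A := by field_simp
  linarith [h2, h3, h4]

/-- **The leading term of the `ρ`-series as a LOWER BOUND**: `(4ρ)^h ≤ k_{2h}(4ρ/(1+ρ)²)` for every `h ≥ 0` and `ρ ∈ (0,1)` —
by Cauchy–Schwarz (`rpow_one_add_le_chiralBlock_mul_inv`) and `z^h (1+ρ)^{2h} = (4ρ)^h`; equality at `h = 0`. This is the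
positivity input of Pappadopulo–Rychkov–Espin–Rattazzi's `ρ`-frame argument for the typed class, without the quadratic
transformation. [cite: PappadopuloRychkovEspinRattazzi2012PRD, §5.2] -/
theorem rpow_four_mul_le_chiralBlock {h ρ : ℝ} (hh : 0 ≤ h) (hρ : ρ ∈ Ioo (0 : ℝ) 1) :
    (4 * ρ) ^ h ≤ chiralBlock h (4 * ρ / (1 + ρ) ^ 2) := by
  rcases hh.lt_or_eq with hpos | hzero
  · have hz := four_mul_div_sq_mem_Ioo hρ
    have hP : 0 < 1 + ρ := by linarith [hρ.1]
    have h4ρ : 0 < 4 * ρ := by linarith [hρ.1]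
    have hzh : 0 < (4 * ρ / (1 + ρ) ^ 2) ^ h := Real.rpow_pos_of_pos hz.1 h
    have h1 := rpow_one_add_le_chiralBlock_mul_inv hpos hρ
    have h2 := mul_le_mul_of_nonneg_right h1 hzh.le
    rw [mul_assoc, inv_mul_cancel₀ hzh.ne', mul_one] at h2
    refine le_trans (le_of_eq ?_) h2
    -- `(4ρ)^h = (1+ρ)^{2h} · (4ρ/(1+ρ)²)^h`
    rw [Real.div_rpow h4ρ.le (pow_nonneg hP.le 2), ← Real.rpow_natCast (1 + ρ), ← Real.rpow_mul hP.le]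
    push_cast
    have hP2h : (1 + ρ) ^ (2 * h) ≠ 0 := (Real.rpow_pos_of_pos hP _).ne'
    field_simp
  · subst hzero; rw [chiralBlock_zero, Real.rpow_zero]

/-- The same bound in PRER's parametrisation: for every `z ∈ (0,1)` and `h ≥ 0`, `(4ρ(z))^h ≤ k_{2h}(z)` with
`ρ(z) = (1-√(1-z))/(1+√(1-z)) = z/(1+√(1-z))²`. [cite: PappadopuloRychkovEspinRattazzi2012PRD, §5.2] -/
theorem rpow_four_mul_rhoZ_le_chiralBlock {h z : ℝ} (hh : 0 ≤ h) (hz : z ∈ Ioo (0 : ℝ) 1) :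
    (4 * ((1 - Real.sqrt (1 - z)) / (1 + Real.sqrt (1 - z)))) ^ h ≤ chiralBlock h z := by
  have h := rpow_four_mul_le_chiralBlock hh (rhoZ_mem_Ioo hz)
  rwa [four_mul_rhoZ_div_sq hz] at h

/-! ### The symmetrised global block on the diagonal -/

/-- **`2(4ρ)^Δ ≤ g_{Δ,ℓ}(z,z)`** at `z = 4ρ/(1+ρ)²` for a unitary label `ℓ ≤ Δ` and `ρ ∈ (0,1)`: both chiral factors obey
`rpow_four_mul_le_chiralBlock` and `h + h̄ = Δ` (the `ρ`-twin of `two_mul_rpow_le_globalBlock_diag`, larger by `(4ρ/z)^Δ`).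
[cite: PappadopuloRychkovEspinRattazzi2012PRD, §5.2] -/
theorem two_mul_rpow_four_mul_le_globalBlock_diag {Δ : ℝ} {ℓ : ℕ} (hΔ : (ℓ : ℝ) ≤ Δ) {ρ : ℝ} (hρ : ρ ∈ Ioo (0 : ℝ) 1) :
    2 * (4 * ρ) ^ Δ ≤ globalBlock Δ ℓ (4 * ρ / (1 + ρ) ^ 2) (4 * ρ / (1 + ρ) ^ 2) := by
  have hℓ : (0 : ℝ) ≤ ℓ := Nat.cast_nonneg ℓ
  have hh : 0 ≤ (Δ + ℓ) / 2 := by linarith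
  have hhb : 0 ≤ (Δ - ℓ) / 2 := by linarith
  have h4ρ : 0 < 4 * ρ := by linarith [hρ.1]
  have A := rpow_four_mul_le_chiralBlock hh hρ
  have B := rpow_four_mul_le_chiralBlock hhb hρ
  have hA0 : 0 ≤ (4 * ρ) ^ ((Δ + ℓ) / 2) := Real.rpow_nonneg h4ρ.le _
  have hB0 : 0 ≤ (4 * ρ) ^ ((Δ - ℓ) / 2) := Real.rpow_nonneg h4ρ.le _
  have hsplit : (4 * ρ) ^ ((Δ + ℓ) / 2) * (4 * ρ) ^ ((Δ - ℓ) / 2) = (4 * ρ) ^ Δ := by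
    rw [← Real.rpow_add h4ρ]; ring_nf
  unfold globalBlock
  nlinarith [mul_le_mul A B hB0 (hA0.trans A), mul_le_mul B A hA0 (hB0.trans B)]

/-- **`g_{Δ,ℓ}(z,z) ≤ 2(z/(1-z))^Δ`** for a unitary label `ℓ ≤ Δ` and `z ∈ (0,1)` (the uniform envelope on both factors).
[folklore] -/
theorem globalBlock_diag_le_two_mul_rpow_div {Δ : ℝ} {ℓ : ℕ} (hΔ : (ℓ : ℝ) ≤ Δ) {z : ℝ} (hz0 : 0 < z) (hz1 : z < 1) :
    globalBlock Δ ℓ z z ≤ 2 * (z / (1 - z)) ^ Δ := by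
  have hℓ : (0 : ℝ) ≤ ℓ := Nat.cast_nonneg ℓ
  have hh : 0 ≤ (Δ + ℓ) / 2 := by linarith
  have hhb : 0 ≤ (Δ - ℓ) / 2 := by linarith
  have hq : 0 < z / (1 - z) := div_pos hz0 (by linarith)
  have A := chiralBlock_le_rpow_div hh hz0 hz1
  have B := chiralBlock_le_rpow_div hhb hz0 hz1
  have hA0 : 0 ≤ chiralBlock ((Δ + ℓ) / 2) z := chiralBlock_nonneg hh ⟨hz0, hz1⟩
  have hB0 : 0 ≤ chiralBlock ((Δ - ℓ) / 2) z := chiralBlock_nonneg hhb ⟨hz0, hz1⟩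
  have hsplit : (z / (1 - z)) ^ ((Δ + ℓ) / 2) * (z / (1 - z)) ^ ((Δ - ℓ) / 2) = (z / (1 - z)) ^ Δ := by
    rw [← Real.rpow_add hq]; ring_nf
  unfold globalBlock
  nlinarith [mul_le_mul A B hB0 (hA0.trans A), mul_le_mul B A hA0 (hB0.trans B)]

/-! ### Scalar bookkeeping for `Control2DOpeDecay` -/

/-- `4^Δ e^{-tΔ} = (4e^{-t})^Δ`. [folklore] -/
theorem four_rpow_mul_exp_neg (t Δ : ℝ) : (4 : ℝ) ^ Δ * Real.exp (-(t * Δ)) = (4 * Real.exp (-t)) ^ Δ := by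
  rw [Real.mul_rpow (by norm_num) (Real.exp_pos _).le, ← Real.exp_mul, neg_mul]

/-- `16^s = 4^{2s}`. [folklore] -/
theorem sixteen_rpow_eq (s : ℝ) : (16 : ℝ) ^ s = (4 : ℝ) ^ (2 * s) := by
  rw [Real.rpow_mul (by norm_num : (0 : ℝ) ≤ 4), show (4 : ℝ) ^ (2 : ℝ) = 16 by norm_num]

/-- `16^{1/8} · y^{1/2} = (2y)^{1/2}` for `y ≥ 0` (`16^{1/8} = √2`; the record's density constant at `Δ_σ = 1/8`). [folklore] -/
theorem sixteen_rpow_eighth_mul {y : ℝ} (hy : 0 ≤ y) :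
    (16 : ℝ) ^ (1 / 8 : ℝ) * y ^ (1 / 2 : ℝ) = (2 * y) ^ (1 / 2 : ℝ) := by
  rw [show (16 : ℝ) = 2 ^ (4 : ℝ) by norm_num, ← Real.rpow_mul (by norm_num), Real.mul_rpow (by norm_num) hy]
  norm_num

/-- `y^{1/2} · 4^{1/4 - Δ} = (2y)^{1/2} · 4^{-Δ}` for `y ≥ 0` (`4^{1/4} = √2`; the record's decay constant at `Δ_σ = 1/8`). [folklore] -/
theorem rpow_half_mul_four_rpow_quarter_sub {y : ℝ} (hy : 0 ≤ y) (Δ : ℝ) :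
    y ^ (1 / 2 : ℝ) * (4 : ℝ) ^ (1 / 4 - Δ) = (2 * y) ^ (1 / 2 : ℝ) * (4 : ℝ) ^ (-Δ) := by
  have h4 : (4 : ℝ) ^ (1 / 4 : ℝ) = (2 : ℝ) ^ (1 / 2 : ℝ) := by
    rw [show (4 : ℝ) ^ (1 / 4 : ℝ) = ((2 : ℝ) ^ (2 : ℝ)) ^ (1 / 4 : ℝ) by norm_num, ← Real.rpow_mul (by norm_num)]
    norm_num
  rw [sub_eq_add_neg, Real.rpow_add (by norm_num : (0 : ℝ) < 4), h4, Real.mul_rpow (by norm_num) hy]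
  ring

end Summit.CriticalPhenomena.Ising3D.Control2D
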